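import Summits.ResolutionOfSingularities.ResolutionOfSingularities.Theorems.EquisingularLiftEquisingularLiftNatModelStepChain
import Summits.ResolutionOfSingularities.ResolutionOfSingularities.Theorems.EquisingularLiftEquisingularLiftNatRegularOfSpecialFibre
import Literature.AlgebraicGeometry.Resolution.BlowupsExistence
import HarnessLib

/-!
# [OURS · L1 W4.5(b) · EL♮(3)] HSUB(ReachTC⁺) — THE CURVE STEP: from an upstairs centre with prescribed special fibre `Z`, regular
# quotient stalks along the special fibre, `O`-flat and off the generic point, the sub-chain supplier's OUTPUT TUPLE for the
# blow-up of `𝓘(Z)` (registered stub `stub_elnat_tcPlusPointResolution`, skeleton v7 d0bdde2a2fc19e04 / child v4 debb68620a62f84a)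

Crux `EquisingularLiftNat` = stmt-ResolutionOfSingularities-20038 (child EL♮(3) = stmt-ResolutionOfSingularities-20148), route
EquisingularLift, line `sections`. Helper file `--supports stmt-ResolutionOfSingularities-20148 --as helper` by res-L1-w45b-stub-1
(HSUB(ReachTC⁺) assembly, skeleton `L/res-L1-w45b-stub-1/HSUB-TCPLUS3-skeleton.lean` 584ed9d307bb8435, brick `inv_final`).
HONEST FRAMING: OURS (cell res-hironaka, slot W4.5(b)); NOT a statement of any manuscript; AI-written, weaker than expert review.
No `sorry`; standard axioms.

WHAT. The LAST step of the sub-chain supplier `HSUB(Reach)` of res-D-pv-029's K5 (`target_elnat_of_subchainResolution`, p522255) for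
res-L1-w45b-lead-2's v7 (TC⁺): the downstairs sub-chain ends with the blow-up `υ' : F₁₀ → F₉` of `𝓘(Z₉)` (`Z₉ ⊆ T₉`, `¬ T₉ ⊆ Z₉`),
and the supplier must return a `Ch`-stage with a model square for `F₁₀` and `j '' closure υ'⁻¹(T₉ ∖ Z₉) = S`, `F₁₀` integral, the
strict-transform set closed irreducible — EXACTLY the conclusion tuple of HSUB. `curveStep_of_centre` produces it from an upstairs
centre `C` on the current stage `X` (for TC⁺: `C = St(𝓢) ⊔ St(K)`, the in-carrier pair of …NatCarrierStrictTransformStalks p522194)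
with: `C · 𝒪_F = 𝓘(Z)` (exactness, res-L1-w45b-stub-1 F⁺5 p519966 + carrier sup p521033), `V(C) → Spec O` flat (T-M1-FLAT p517580),
`σ '' supp C` off the generic point of `Y`, and REGULAR QUOTIENT STALKS `𝒪_{X,x}/C_x` AT THE POINTS OVER THE CLOSED POINT only
(res-L1-w45b-stub-3 p515745 (iv) at order-one points, the Δ-package of T-ΔLIFT-CENTRED p523916 at the finitely many others) — the
regularity of `V(C)` at ALL points then follows because `V(C)` is proper over `O` (res-type-032's glue
`Scheme.isRegular_subscheme_of_forall_over_closedPoint`, p503424): regularity generises from the special fibre.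

* `curveStep_of_centre` — INPUT: the engine context of K5 (`θ : O ↠ k`, `q : P → Spec O` proper, `Y` closed irreducible, `Ch` with
  its closure property and `Ch ⇒ Split.Chain`), a `Ch`-stage `(X, σ, S)` (integral, locally Noetherian, regular, dominant, `σ`
  proper) with model square `j : F → X` (`F` integral), `j '' T = S`; a closed `Z ⊆ T`, `¬ T ⊆ Z`; a centre `C` with
  `C.comap j = vanishingIdeal ⟨Z, _⟩`, `Flat (C.subschemeι ≫ σ ≫ q)`, regular quotient stalks over the closed point, off-generic;
  a blow-up `υ` of `F` along `𝓘(Z)`. OUTPUT: HSUB's tuple for `(F₂, υ, closure υ⁻¹(T ∖ Z))` — via `exists_isBlowup` +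
  res-D-pv-029's `modelStep_chain` (p523633-series, …NatModelStepChain).

References: res-D-pv-029 …NatModelStepChain / …NatSubchainPointResolution (p522255); res-type-032 …NatRegularOfSpecialFibre (p503424);
res-L1-w45b-lead-2 TARGET-TCPLUS rev 3 / TC⁺-INST (OURS planning texts, index only).
-/

set_option linter.dupNamespace false -- mandated namespace `Summit.<Summit>.<Problem>` of this single-conjunct summit
set_option linter.overlappingInstances false -- signatures carry `[IsDomain O] [IsDiscreteValuationRing O]`

noncomputable section

open CategoryTheory CategoryTheory.Limits AlgebraicGeometry TopologicalSpace Topology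
open Literature.AlgebraicGeometry.Resolution
open AlgebraicGeometry.Scheme.IdealSheafData
open Summit.ResolutionOfSingularities.ResolutionOfSingularities.Theses.EquisingularLift.Split
open Summit.ResolutionOfSingularities.ResolutionOfSingularities.Cruxes.EquisingularLift.StrataSplit

namespace Summit.ResolutionOfSingularities.ResolutionOfSingularities.Cruxes.EquisingularLiftNat.Sections

/-- **HSUB(ReachTC⁺) — the curve step.** See the module docstring. [folklore; assembly of `exists_isBlowup`, res-D-pv-029's
`modelStep_chain` and res-type-032's `Scheme.isRegular_subscheme_of_forall_over_closedPoint`]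
[OURS · L1 W4.5b] toward `stub_elnat_tcPlusPointResolution` (stmt-ResolutionOfSingularities-20038 / -20148); NOT a statement of the
manuscript. -/
theorem curveStep_of_centre (O : Type) [CommRing O] [IsDomain O] [IsDiscreteValuationRing O] (k : Type) [Field k]
    (θ : O →+* k) (hθ : Function.Surjective θ)
    (P : Scheme.{0}) (q : P ⟶ Spec (.of O)) (Y : Set P) (hYirr : IsIrreducible Y) (hYcl : IsClosed Y)
    (Ch : ∀ X' : Scheme.{0}, (X' ⟶ P) → Set X' → Prop)
    (hChain : ∀ (X' : Scheme.{0}) (σ : X' ⟶ P) (S : Set X'), Ch X' σ S → Chain P Y X' σ S)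
    (hStep : ∀ (X' X'' : Scheme.{0}) (σ' : X' ⟶ P) (S' : Set X') (C : X'.IdealSheafData) (τ : X'' ⟶ X'),
      Ch X' σ' S' → IsBlowup τ C → Scheme.IsRegular C.subscheme → Flat (C.subschemeι ≫ σ' ≫ q) →
      σ' '' (C.support : Set X') ⊆ {x : P | ¬ IsGenericPoint x Y} →
      (C.support : Set X') ∩ (σ' ≫ q) ⁻¹' {IsLocalRing.closedPoint O} ⊆ S' →
      Ch X'' (τ ≫ σ') (closure (τ ⁻¹' (S' \ (C.support : Set X')))))
    -- the stage and its model
    (X : Scheme.{0}) (σ : X ⟶ P) (S : Set X) (hCh : Ch X σ S) [IsIntegral X] [IsLocallyNoetherian X]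
    (hreg : Scheme.IsRegular X) (hdom : IsDominant (σ ≫ q)) [IsProper (σ ≫ q)]
    (F : Scheme.{0}) [IsIntegral F] (j : F ⟶ X) (t : F ⟶ Spec (.of k))
    (hsq : IsPullback j t (σ ≫ q) (Spec.map (CommRingCat.ofHom θ)))
    (T : Set F) (hTS : j '' T = S)
    -- the downstairs centre `𝓘(Z)` and the upstairs centre `C`
    (Z : Set F) (hZ : IsClosed Z) (hZT : Z ⊆ T) (hTZ : ¬ T ⊆ Z)
    (C : X.IdealSheafData) (hCD : C.comap j = vanishingIdeal ⟨Z, hZ⟩)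
    (hCflat : Flat (C.subschemeι ≫ σ ≫ q))
    (hCreg : ∀ x ∈ (C.support : Set X), (σ ≫ q) x = IsLocalRing.closedPoint O →
      IsRegularLocalRing (X.presheaf.stalk x ⧸ stalkIdeal C x))
    (hoff : σ '' (C.support : Set X) ⊆ {x : P | ¬ IsGenericPoint x Y})
    -- the downstairs blow-up
    (F₂ : Scheme.{0}) (υ : F₂ ⟶ F) (hυ : IsBlowup υ (vanishingIdeal ⟨Z, hZ⟩)) :
    ∃ (X₂ : Scheme.{0}) (σ₂ : X₂ ⟶ P) (S₂ : Set X₂) (j₂ : F₂ ⟶ X₂) (t₂ : F₂ ⟶ Spec (.of k)),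
      Ch X₂ σ₂ S₂ ∧ IsIntegral X₂ ∧ IsLocallyNoetherian X₂ ∧ Scheme.IsRegular X₂ ∧ IsDominant (σ₂ ≫ q) ∧
      IsPullback j₂ t₂ (σ₂ ≫ q) (Spec.map (CommRingCat.ofHom θ)) ∧ j₂ '' closure (υ ⁻¹' (T \ Z)) = S₂ ∧
      IsClosed (closure (υ ⁻¹' (T \ Z))) ∧ IsIrreducible (closure (υ ⁻¹' (T \ Z))) ∧ IsIntegral F₂ := by
  -- the centre is regular: regular quotient stalks over the closed point + properness over `O`
  haveI : IsProper (C.subschemeι ≫ σ ≫ q) := inferInstance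
  have hCreg' : Scheme.IsRegular C.subscheme :=
    Scheme.isRegular_subscheme_of_forall_over_closedPoint (σ ≫ q) C fun x hx hqx => hCreg x hx hqx
  -- the support of the downstairs centre is `Z`
  have hsuppZ : ((vanishingIdeal ⟨Z, hZ⟩ : F.IdealSheafData).support : Set F) = Z := coe_support_vanishingIdeal _
  have hDT : ((vanishingIdeal ⟨Z, hZ⟩ : F.IdealSheafData).support : Set F) ⊆ T := by rw [hsuppZ]; exact hZT
  have hTD : ¬ T ⊆ ((vanishingIdeal ⟨Z, hZ⟩ : F.IdealSheafData).support : Set F) := by rw [hsuppZ]; exact hTZ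
  -- blow up `C` and run the model step in chain currency
  obtain ⟨X₂, τ, hτ⟩ := exists_isBlowup X C
  obtain ⟨hint₂, hnoeth₂, hreg₂, hdom₂, hF₂, hirr, j₂, t₂, hsq₂, hcomm, hCh₂⟩ :=
    modelStep_chain O k θ hθ P q Y hYirr hYcl Ch hChain hStep X σ S hCh hreg hdom F j t hsq T hTS C (vanishingIdeal ⟨Z, hZ⟩) hCD
      hCreg' hCflat hoff hDT hTD X₂ τ hτ F₂ υ hυ
  rw [hsuppZ] at hirr hCh₂
  exact ⟨X₂, τ ≫ σ, j₂ '' closure (υ ⁻¹' (T \ Z)), j₂, t₂, hCh₂, hint₂, hnoeth₂, hreg₂, hdom₂, hsq₂, rfl, isClosed_closure,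
    hirr, hF₂⟩

end Summit.ResolutionOfSingularities.ResolutionOfSingularities.Cruxes.EquisingularLiftNat.Sections

end
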